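/-
Copyright: lit-balaban Phase-2 proof seat p33 (gen 4).  Statement-level skeleton of a published paper; no proof claims beyond what
the kernel checks below.
-/
import Literature.MathematicalPhysics.QuantumFieldTheory.BalabanImbrieJaffe1984to88.BIJ85SigmaGaugeInvariance
import Literature.MathematicalPhysics.QuantumFieldTheory.BalabanImbrieJaffe1984to88.BIJ85LandauMinimizer442V1

/-!
# `BalabanImbrieJaffe1984to88.BIJ85LandauCurlG` — T. Bałaban, J. Imbrie, A. Jaffe, *Renormalization of the Higgs model: minimizers,
propagators and the stability of mean field theory*, Commun. Math. Phys. **97** (1985) 299–329 [BalabanImbrieJaffe1985]: p. 322 —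
**the Landau-gauge replacement `∂G_{k,Ax}∂^* = ∂G_k∂^*`**, with `G_k` the propagator (4.1.1) whose gauge-fixing δ-function
`δ_{k,Ax}(A)` is replaced by the Faddeev–Popov function `𝒢(∂^*A)` of (4.4.1) — PROVED abstractly (any Gaussian gauge fixing
`e^{−½‖TA‖²}` accessible along `∂`-invisible directions) and ON THE TORI of the series (seat p11's V1 Landau data `opsV1`)

statement-level skeleton of published theorems with citation tags; proofs where landed; nothing here is a claim about the Yang–Mills mass gap

PDF held: `paper:balaban1985-cmp97-bij-higgs-minimizers` (journal page = PDF page + 298).  Pages read as images: p. 322 [PDF 24]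
(`run/shared/lean/pub/pub-balaban/t4/b2b-balaban-t4-lit2/renders/bij1985/1985-cmp97-bij-higgs-minimizers-p024-x2.png`), p. 310–311
[PDF 12–13] (`…-p012-x2.png`, `…-p013-x2.png`).

CITATION HEADER (lean-in-tree rule).  Part of the lit-balaban TYPED SKELETON (HOME `run/shared/lean/pub/lit-balaban/`), Phase-2 seat
p33 (gen 4), unit `lit-balaban-p33`; rows **C1.Eq7.1.2-7.1.12** (the p. 322 sentence below; (7.1.12)), **C1.Eq4.2.1-4.2.2** (p. 310
*"∂G_{k,Ax}∂^* … is invariant under a change of gauge"*) and **C1.Eq4.4.1-4.4.3** (uses) of `HOME/SKELETON.md` (owner r15, referee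
ref-5) — companion of seat p09's `BIJ85AxialPropagator411`/`BIJ85SigmaForm421` ((4.1.1) as a constrained Gaussian second moment
`axialPropagator V D`, the projection `∂G_V∂^* = curlG V D`, σ_k = `sigmaOp`), of this seat's `BIJ85SigmaGaugeInvariance` (gen 3:
`∂G_V∂^*` depends on the δ-gauge `V` only through `∂V`; the k-axial gauge is accessible inside `δ(Q_kA)`), and of seat p11's
`BIJ85LandauForm441`/`BIJ85LandauMinimizer442(V1)` (the Landau operators `LandauOps`, `R` = `projR`, the weight
`𝒢(∂^*A)e^{−½‖∂A‖²} = c_R⁻¹e^{−½‖∂A‖²−½‖R∂^*A‖²}` (`weight_eq`), the V1 instance `opsV1` with its no-zero-modes theorem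
`noZeroModes_V1` and gauge structure `gaugeStructure_V1`) — all USED, none edited.

THE PRINTED TEXT (p. 322 [PDF 24], verbatim): *"The basic object we wish to study is σ_k, defined in (4.2.2), σ_k = Q^e_k(I −
∂G_{k,Ax}∂^*)Q^{e*}_k. (7.1.12) The axial gauge Green's function G_{k,Ax} has a very complicated momentum space structure. Thus we
use gauge invariance of ∂G_{k,Ax}∂^* to replace it by the Landau gauge operator ∂G_k∂^*. Here we emphasize that G_k is a slightly
different operator from 𝒟_k introduced in Sect. 4. The transformation G_k is defined by replacing the gauge-fixing delta function
δ_{k,Ax}(A) in (4.1.1) by the Landau-gauge fixing function 𝒢(∂^*A) of (4.4.1). The operator G_k was given in the momentum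
representation in [6I, Eqs. (1.83) and (1.84)]."*; p. 310 [PDF 12]: *"The right side of (4.2.2) involves the combination ∂G_{k,Ax}∂^*
which is invariant under a change of gauge. Hence the gauge chosen to define σ_k is irrelevant"*.

THE TYPING.  `G_k` := the second moment of the Gaussian `e^{−½‖∂A‖²−½‖TA‖²}` on the constraint subspace `N = {Q_kA = 0}`, with
`T = R∂^*` (so that, by p11's `weight_eq`, the weight IS `𝒢(∂^*A)e^{−½‖∂A‖²}` up to the constant `c_R⁻¹`, which cancels against
`Z`): in p09's operator language `G_k = ι_N(ι_N^*∂′^*∂′ι_N)⁻¹ι_N^* = axialPropagator N ∂′` for the EXTENDED CURL `∂′A = (∂A, TA)`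
into the `L²`-product `F × S` (`landauD`, `landauPropagator`) — definitions with bodies, no `Prop`.

WHAT IS PROVED (D-0026: no new named fact; the two hypotheses of the abstract theorem are DISCHARGED on the tori in §2).
* §1 ABSTRACT (finite-dimensional real inner product spaces `E` ⊇ `N`, `F`, `S`; `D = ∂`, `T`): `‖∂′v‖² = ‖∂v‖² + ‖Tv‖²`
  (`norm_landauD_sq`); **(4.1.1) with `δ_{k,Ax}` replaced by the Gaussian gauge fixing** — `exp(½⟨J, G_kJ⟩) = Z⁻¹∫_N
  e^{−½‖∂A‖²−½‖TA‖²+⟨A,J⟩}dA`, `Z > 0`, whenever there are no Landau zero modes on `N` (`∂v = 0 ∧ Tv = 0 ⇒ v = 0`)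
  (`isLandauPropagator`, p09's `isAxialPropagator_axialPropagator`); `∂G_k∂^* = π ∘ (∂′G_k∂′^*) ∘ π^*` with `π` the `F`-corner
  (`curl_landauPropagator_curlAdj`); and **`∂G_k∂^* = ∂G_V∂^*`** (`= curlG V D`, the orthogonal projection onto
  `∂V`) for EVERY zero-mode-free δ-gauge `V` with `∂V = ∂N`, under (hZ) no Landau zero modes and (hAcc) LANDAU-GAUGE ACCESSIBILITY
  along `∂`-invisible directions: every `A ∈ N` decomposes `A = g + w` in `N` with `∂g = 0`, `Tw = 0`
  (`curl_landauPropagator_curlAdj_eq_curlG`; mechanism: `π∂′G_k∂′^*π^*` is symmetric, ranges in `∂N`, and fixes `∂N` because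
  `(∂u, 0) = ∂′w`); hence `Q^e_k(I − ∂G_V∂^*)Q^{e*}_k = Q^e_k(I − ∂G_k∂^*)Q^{e*}_k` (`sigmaOp_eq_landau`);
* §2 ON THE TORI (`Setup` carriers; `∂ = curlOp w c = (opsV1 P k c √w).curl`, `T = R∂^*` of p11's `opsV1 P k c √w`, `N = ker Q_k`;
  standing range `k ≤ m + K`, `w > 0`, `c ≠ 0`, `2 ≤ d`): (hZ) = p11's `noZeroModes_V1`, (hAcc) from p11's `gaugeStructure_V1`
  and `projR_lap_of_mem` (`g = ∂λ`, `Δλ = R∂^*A`, `λ ∈ N(Q′_k)`) (`landauAccessible_torus`), `∂(ker Q_k) = ∂(V411 P k)` (gen 3;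
  `map_curlOp_kerQk_eq`); so **`∂G_k∂^* = ∂G_{k,Ax}∂^*` on the tori** (`curl_landauPropagator_curlAdj_torus`), **σ_k of (4.2.2) =
  `Q^{e*†}_k(I − ∂G_k∂^*)Q^{e*}_k`** (`sigmaTorus_eq_landau`, the form Sect. 7 starts from), and the Gaussian reading of `G_k` with
  p11's weight `𝒢(∂^*A)e^{−½‖∂A‖²}` verbatim (`landauPropagator_torus_weight`), hypothesis-free in the standing range.
NOT CLAIMED: the momentum representation [6I] (1.83)–(1.84) of `G_k` (row C1.Eq7.1.2-7.1.12, seats p27/p10), nor `G_k = 𝒟_k`-type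
comparisons of Sect. 5.  Unit `lit-balaban-p33` (literature-prover-lit-balaban-p33-g4-0), 2026-08-21.
-/

open scoped RealInnerProductSpace

namespace Literature.MathematicalPhysics.QuantumFieldTheory.BalabanImbrieJaffe1984to88.BIJ85LandauCurlG

open MeasureTheory
open BIJ85AxialPropagator411 BIJ85AxialMinimizer413 BIJ85SigmaForm421 BIJ85Sigma421Torus BIJ85SigmaGaugeInvariance

noncomputable section

/-! ## 1. Abstract: the Landau propagator and `∂G_k∂^* = ∂G_V∂^*` -/

section Abstract

variable {E F S F' : Type*} [NormedAddCommGroup E] [InnerProductSpace ℝ E] [FiniteDimensional ℝ E]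
  [NormedAddCommGroup F] [InnerProductSpace ℝ F] [FiniteDimensional ℝ F]
  [NormedAddCommGroup S] [InnerProductSpace ℝ S] [FiniteDimensional ℝ S]
  [NormedAddCommGroup F'] [InnerProductSpace ℝ F'] [FiniteDimensional ℝ F']

/-- The EXTENDED CURL `∂′A = (∂A, TA)` into the `L²`-product of plaquette fields and gauge-fixing values (`T = R∂^*` for the
Landau gauge fixing (4.4.1)): `‖∂′A‖² = ‖∂A‖² + ‖TA‖²` is the exponent of `𝒢(∂^*A)e^{−½‖∂A‖²}` (p11's `weight_eq`).
[cite: BalabanImbrieJaffe1985, (7.1.12) p.322] -/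
def landauD (D : E →ₗ[ℝ] F) (T : E →ₗ[ℝ] S) : E →ₗ[ℝ] WithLp 2 (F × S) :=
  (WithLp.linearEquiv 2 ℝ (F × S)).symm.toLinearMap ∘ₗ D.prod T

omit [FiniteDimensional ℝ E] [FiniteDimensional ℝ F] [FiniteDimensional ℝ S] in
/-- Components of the extended curl. [cite: BalabanImbrieJaffe1985, (7.1.12) p.322] -/
@[simp] theorem landauD_apply (D : E →ₗ[ℝ] F) (T : E →ₗ[ℝ] S) (v : E) : landauD D T v = WithLp.toLp 2 (D v, T v) := rfl

omit [FiniteDimensional ℝ E] [FiniteDimensional ℝ F] [FiniteDimensional ℝ S] in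
/-- `‖∂′A‖² = ‖∂A‖² + ‖TA‖²`. [cite: BalabanImbrieJaffe1985, (7.1.12) p.322] -/
theorem norm_landauD_sq (D : E →ₗ[ℝ] F) (T : E →ₗ[ℝ] S) (v : E) : ‖landauD D T v‖ ^ 2 = ‖D v‖ ^ 2 + ‖T v‖ ^ 2 := by
  rw [landauD_apply, WithLp.prod_norm_sq_eq_of_L2]
  rfl

omit [FiniteDimensional ℝ E] [FiniteDimensional ℝ F] [FiniteDimensional ℝ S] in
/-- The `F`-corner recovers the curl: `π ∘ ∂′ = ∂`. [cite: BalabanImbrieJaffe1985, (7.1.12) p.322] -/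
theorem fst_comp_landauD (D : E →ₗ[ℝ] F) (T : E →ₗ[ℝ] S) : WithLp.fstₗ 2 ℝ F S ∘ₗ landauD D T = D := by
  refine LinearMap.ext fun v => ?_
  rfl

/-- The adjoint of the `F`-corner `π` is the inclusion `g ↦ (g, 0)`. [folklore] -/
private theorem adjoint_fst_apply (g : F) : LinearMap.adjoint (WithLp.fstₗ 2 ℝ F S) g = WithLp.toLp 2 (g, 0) := by
  apply ext_inner_left ℝ
  intro x
  rw [LinearMap.adjoint_inner_right, WithLp.prod_inner_apply, WithLp.ofLp_toLp]
  show ⟪WithLp.fst x, g⟫ = ⟪(WithLp.ofLp x).1, g⟫ + ⟪(WithLp.ofLp x).2, (0 : S)⟫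
  rw [inner_zero_right, add_zero]
  rfl

/-- **`G_k`** (p. 322: *"The transformation G_k is defined by replacing the gauge-fixing delta function δ_{k,Ax}(A) in (4.1.1) by the
Landau-gauge fixing function 𝒢(∂^*A) of (4.4.1)"*): the second moment of `e^{−½‖∂A‖²−½‖TA‖²}` on the constraint subspace `N`
(`T = R∂^*`), in p09's operator form `ι_N(ι_N^*∂′^*∂′ι_N)⁻¹ι_N^*` for the extended curl `∂′`. [cite: BalabanImbrieJaffe1985, (7.1.12) p.322] -/
def landauPropagator (N : Submodule ℝ E) (D : E →ₗ[ℝ] F) (T : E →ₗ[ℝ] S) : E →ₗ[ℝ] E :=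
  axialPropagator N (landauD D T)

omit [FiniteDimensional ℝ E] [FiniteDimensional ℝ F] [FiniteDimensional ℝ S] in
/-- No Landau zero modes on `N` (`∂v = 0 ∧ Tv = 0 ⇒ v = 0`) ⇒ the extended curl has none. [cite: BalabanImbrieJaffe1985, (7.1.12) p.322] -/
theorem noZeroModes_landauD {N : Submodule ℝ E} {D : E →ₗ[ℝ] F} {T : E →ₗ[ℝ] S}
    (hZ : ∀ v : N, D (v : E) = 0 → T (v : E) = 0 → v = 0) :
    ∀ v : N, landauD D T (v : E) = 0 → v = 0 := by
  intro v hv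
  have h := congrArg WithLp.ofLp hv
  simp only [landauD_apply, WithLp.ofLp_toLp, WithLp.ofLp_zero, Prod.mk_eq_zero] at h
  exact hZ v h.1 h.2

/-- **(4.1.1) with `δ_{k,Ax}` replaced by the Gaussian gauge fixing**: without Landau zero modes on `N`,
`exp(½⟨J, G_kJ⟩) = Z⁻¹∫_N exp(−½(‖∂A‖² + ‖TA‖²) + ⟨A, J⟩)dA` for every source `J`, with `Z = ∫_N exp(−½(‖∂A‖² + ‖TA‖²))dA > 0`
(p09's `isAxialPropagator_axialPropagator` for the extended curl). [cite: BalabanImbrieJaffe1985, (4.1.1) p.309] -/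
theorem isLandauPropagator [MeasurableSpace E] [BorelSpace E] {N : Submodule ℝ E} {D : E →ₗ[ℝ] F} {T : E →ₗ[ℝ] S}
    (hZ : ∀ v : N, D (v : E) = 0 → T (v : E) = 0 → v = 0) :
    (∀ J : E, Real.exp ((1 / 2) * ⟪J, landauPropagator N D T J⟫) =
      (∫ v : N, Real.exp (-(1 / 2) * (‖D (v : E)‖ ^ 2 + ‖T (v : E)‖ ^ 2)))⁻¹ *
        ∫ v : N, Real.exp (-(1 / 2) * (‖D (v : E)‖ ^ 2 + ‖T (v : E)‖ ^ 2) + ⟪(v : E), J⟫)) ∧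
    0 < ∫ v : N, Real.exp (-(1 / 2) * (‖D (v : E)‖ ^ 2 + ‖T (v : E)‖ ^ 2)) := by
  obtain ⟨h, hpos⟩ := isAxialPropagator_axialPropagator N (landauD D T) (noZeroModes_landauD hZ)
  simp only [IsAxialPropagator, Z, gen, norm_landauD_sq] at h hpos
  exact ⟨h, hpos⟩

/-- **`∂G_k∂^*` is the `F`-corner of the projection `∂′G_k∂′^*`**: `∂ ∘ G_k ∘ ∂^* = π ∘ curlG N ∂′ ∘ π^*` (since `∂ = π ∘ ∂′`).
[cite: BalabanImbrieJaffe1985, (7.1.12) p.322] -/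
theorem curl_landauPropagator_curlAdj (N : Submodule ℝ E) (D : E →ₗ[ℝ] F) (T : E →ₗ[ℝ] S) :
    D ∘ₗ landauPropagator N D T ∘ₗ LinearMap.adjoint D =
      WithLp.fstₗ 2 ℝ F S ∘ₗ curlG N (landauD D T) ∘ₗ LinearMap.adjoint (WithLp.fstₗ 2 ℝ F S) := by
  have hadj : ∀ x : F, LinearMap.adjoint D x =
      LinearMap.adjoint (landauD D T) (LinearMap.adjoint (WithLp.fstₗ 2 ℝ F S) x) := by
    intro x
    apply ext_inner_right ℝ
    intro v
    rw [LinearMap.adjoint_inner_left, LinearMap.adjoint_inner_left, LinearMap.adjoint_inner_left]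
    rfl
  refine LinearMap.ext fun x => ?_
  simp only [landauPropagator, axialPropagator, curlG, LinearMap.comp_apply, hadj]
  rfl

omit [FiniteDimensional ℝ F] in
/-- Two symmetric operators that range in a subspace `U` and fix `U` pointwise coincide (both are the orthogonal projection onto `U`).
[folklore] -/
private theorem eq_of_projLike {U : Submodule ℝ F} {K₁ K₂ : F →ₗ[ℝ] F}
    (s₁ : ∀ x y, ⟪K₁ x, y⟫ = ⟪x, K₁ y⟫) (r₁ : ∀ x, K₁ x ∈ U) (i₁ : ∀ u ∈ U, K₁ u = u)
    (s₂ : ∀ x y, ⟪K₂ x, y⟫ = ⟪x, K₂ y⟫) (r₂ : ∀ x, K₂ x ∈ U) (i₂ : ∀ u ∈ U, K₂ u = u) : K₁ = K₂ := by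
  refine LinearMap.ext fun x => ext_inner_right ℝ fun y => ?_
  calc ⟪K₁ x, y⟫ = ⟪K₂ (K₁ x), y⟫ := by rw [i₂ _ (r₁ x)]
    _ = ⟪K₁ x, K₂ y⟫ := s₂ _ _
    _ = ⟪x, K₁ (K₂ y)⟫ := s₁ _ _
    _ = ⟪x, K₂ y⟫ := by rw [i₁ _ (r₂ y)]
    _ = ⟪K₂ x, y⟫ := (s₂ x y).symm

/-- **`∂G_k∂^* = ∂G_V∂^*`** (p. 322: *"we use gauge invariance of ∂G_{k,Ax}∂^* to replace it by the Landau gauge operator ∂G_k∂^*"*;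
p. 310: *"∂G_{k,Ax}∂^* … is invariant under a change of gauge"*): for the Gaussian gauge fixing `T` on the constraint subspace `N`
WITHOUT Landau zero modes (`hZ`) and ACCESSIBLE along `∂`-invisible directions (`hAcc`: every `A ∈ N` is `g + w` in `N` with
`∂g = 0`, `Tw = 0` — for `T = R∂^*`: `g = ∂λ`, `λ ∈ N(Q′_k)`, `Δλ = R∂^*A`), and for every zero-mode-free δ-function gauge `V` with the
same plaquette variables `∂V = ∂N` (e.g. the axial gauge), `∂ ∘ G_k ∘ ∂^* = ∂G_V∂^*` = p09's `curlG V D`, the orthogonal projection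
onto `∂V`. [cite: BalabanImbrieJaffe1985, (7.1.12) p.322] -/
theorem curl_landauPropagator_curlAdj_eq_curlG {N V : Submodule ℝ E} {D : E →ₗ[ℝ] F} {T : E →ₗ[ℝ] S}
    (hZ : ∀ v : N, D (v : E) = 0 → T (v : E) = 0 → v = 0)
    (hAcc : ∀ u ∈ N, ∃ g ∈ N, D g = 0 ∧ T (u - g) = 0)
    (hV : ∀ v : V, D (v : E) = 0 → v = 0) (hmap : V.map D = N.map D) :
    D ∘ₗ landauPropagator N D T ∘ₗ LinearMap.adjoint D = curlG V D := by
  rw [curl_landauPropagator_curlAdj]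
  have hZ' := noZeroModes_landauD hZ
  refine eq_of_projLike (U := N.map D) ?_ ?_ ?_ (fun x y => curlG_symm hV x y) ?_ ?_
  · intro x y
    simp only [LinearMap.comp_apply]
    rw [← LinearMap.adjoint_inner_right (WithLp.fstₗ 2 ℝ F S), curlG_symm hZ', LinearMap.adjoint_inner_left]
  · intro x
    obtain ⟨v, hv⟩ := curlG_mem_range N (landauD D T) (LinearMap.adjoint (WithLp.fstₗ 2 ℝ F S) x)
    simp only [LinearMap.comp_apply]
    rw [hv]
    exact ⟨(v : E), v.2, rfl⟩
  · intro u hu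
    obtain ⟨u', hu', rfl⟩ := Submodule.mem_map.1 hu
    obtain ⟨g, hg, hDg, hT⟩ := hAcc u' hu'
    have hw : u' - g ∈ N := N.sub_mem hu' hg
    have hkey : LinearMap.adjoint (WithLp.fstₗ 2 ℝ F S) (D u') = landauD D T ((⟨u' - g, hw⟩ : N) : E) := by
      rw [adjoint_fst_apply, landauD_apply, Submodule.coe_mk, map_sub, hDg, sub_zero, hT]
    simp only [LinearMap.comp_apply]
    rw [hkey, curlG_apply_curl hZ' ⟨u' - g, hw⟩]
    show D (u' - g) = D u'
    rw [map_sub, hDg, sub_zero]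
  · intro x
    rw [← hmap]
    exact curlG_mem_map V D x
  · intro u hu
    rw [← hmap] at hu
    exact curlG_apply_of_mem_map hV hu

/-- **σ_k with the Landau `G_k`**: `Q^e_k(I − ∂G_V∂^*)Q^{e*}_k = Q^e_k(I − ∂G_k∂^*)Q^{e*}_k` — the form of (7.1.12) from which Sect. 7
proceeds (same hypotheses). [cite: BalabanImbrieJaffe1985, (7.1.12) p.322] -/
theorem sigmaOp_eq_landau {N V : Submodule ℝ E} {D : E →ₗ[ℝ] F} {T : E →ₗ[ℝ] S}
    (hZ : ∀ v : N, D (v : E) = 0 → T (v : E) = 0 → v = 0)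
    (hAcc : ∀ u ∈ N, ∃ g ∈ N, D g = 0 ∧ T (u - g) = 0)
    (hV : ∀ v : V, D (v : E) = 0 → v = 0) (hmap : V.map D = N.map D) (Qes : F' →ₗ[ℝ] F) :
    sigmaOp V D Qes =
      LinearMap.adjoint Qes ∘ₗ (LinearMap.id - D ∘ₗ landauPropagator N D T ∘ₗ LinearMap.adjoint D) ∘ₗ Qes := by
  rw [curl_landauPropagator_curlAdj_eq_curlG hZ hAcc hV hmap]
  rfl

end Abstract

/-! ## 2. On the tori: the hypotheses discharged with p11's V1 Landau data -/

section Torus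

open Literature.MathematicalPhysics.QuantumFieldTheory.Balaban1983to89
open LatticeFieldCalculus BIJ85LandauForm441 BIJ85LandauMinimizer442 BIJ85LandauMinimizer442V1 BIJ85NoZeroModes309Torus

variable {P : Params}

/-- `(a⁻¹z)⁻¹(a⁻¹i) = z⁻¹i` for `a ≠ 0` (cancellation of the Faddeev–Popov constant `c_R⁻¹`). [folklore] -/
private theorem cancel_aux {a : ℝ} (z i : ℝ) (ha : a ≠ 0) : (a⁻¹ * z)⁻¹ * (a⁻¹ * i) = z⁻¹ * i := by
  rw [mul_inv, inv_inv]
  calc a * z⁻¹ * (a⁻¹ * i) = (a * a⁻¹) * (z⁻¹ * i) := by ring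
    _ = z⁻¹ * i := by rw [mul_inv_cancel₀ ha, one_mul]

/-- p11's V1 curl with the norm weight `s = √w` IS p09's weighted curl `curlOp w c = √w·∂_c`. [cite: BalabanImbrieJaffe1985, (4.4.1)–(4.4.3) p.311–312] -/
theorem opsV1_curl_eq_curlOp (k : ℕ) (w c : ℝ) : (opsV1 P k c (Real.sqrt w)).curl = curlOp (P := P) w c := by
  refine LinearMap.ext fun v => ?_
  ext p
  rw [opsV1_curl, PiLp.smul_apply, smul_eq_mul]
  rfl

/-- The gauge-fixing operator `T = R∂^*` of the V1 Landau data (p11's `projR ∘ dstar`). [cite: BalabanImbrieJaffe1985, (4.4.1) p.311] -/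
abbrev landauT (P : Params) (k : ℕ) (c s : ℝ) : BondSpace P →ₗ[ℝ] EuclideanSpace ℝ (Site P 0) :=
  ((opsV1 P k c s).projR : EuclideanSpace ℝ (Site P 0) →ₗ[ℝ] EuclideanSpace ℝ (Site P 0)) ∘ₗ (opsV1 P k c s).dstar

/-- Membership in `ker Q_k` of the V1 data: `Q_kA = 0` for the underlying bond field. [cite: BalabanImbrieJaffe1985, (4.4.3) p.312] -/
theorem mem_kerQk_iff (k : ℕ) (c s : ℝ) (v : BondSpace P) :
    v ∈ (opsV1 P k c s).kerQk ↔ bondAvgIter k (WithLp.ofLp v) = 0 := by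
  rw [LandauOps.mem_kerQk, opsV1_Qk]

/-- **(hZ) on the torus**: no Landau zero modes on `ker Q_k` — p11's `noZeroModes_V1` ([6I] p. 30), read for the subtype (standing
range, `c ≠ 0`, `s ≠ 0`). [cite: Balaban1984PropagatorsI, (1.72) p.30] -/
theorem noLandauZeroModes_torus {k : ℕ} (hk : k ≤ P.m + P.K) {c s : ℝ} (hc : c ≠ 0) (hs : s ≠ 0) :
    ∀ v : (opsV1 P k c s).kerQk, (opsV1 P k c s).curl (v : BondSpace P) = 0 →
      landauT P k c s (v : BondSpace P) = 0 → v = 0 := by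
  intro v hcurl hT
  have hQ : (opsV1 P k c s).Qk (v : BondSpace P) = 0 := (LandauOps.mem_kerQk _).1 v.2
  exact Subtype.ext (noZeroModes_V1 hk hc hs (v : BondSpace P) hQ hcurl hT)

/-- **(hAcc) on the torus — the Landau gauge is accessible inside `δ(Q_kA)` along gauge directions**: every `A` with `Q_kA = 0`
splits as `A = ∂λ + w` with `λ ∈ N(Q′_k)` (so `Q_k∂λ = 0`, `∂(∂λ) = 0`) and `R∂^*w = 0`, `λ` solving `Δλ = R∂^*A ∈ ΔN(Q′_k)` ([6I]
p. 25: *"RΔλ = Δλ if Q′_kλ = 0"*; p11's `gaugeStructure_V1`, `projR_lap_of_mem`). [cite: Balaban1984PropagatorsI, (1.47) p.26] -/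
theorem landauAccessible_torus {k : ℕ} (hk : k ≤ P.m + P.K) (c s : ℝ) :
    ∀ u ∈ (opsV1 P k c s).kerQk, ∃ g ∈ (opsV1 P k c s).kerQk,
      (opsV1 P k c s).curl g = 0 ∧ landauT P k c s (u - g) = 0 := by
  intro u hu
  set Dl := opsV1 P k c s with hDl
  have hmem : Dl.projR (Dl.dstar u) ∈ Dl.gaugeRange := Submodule.starProjection_apply_mem _ _
  obtain ⟨l, hl, hlap⟩ := Submodule.mem_map.1 hmem
  have hl' : Dl.Qp l = 0 := (LandauOps.mem_kerQp _).1 hl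
  have hgs := gaugeStructure_V1 (P := P) hk c s
  refine ⟨gradV1 P c l, (LandauOps.mem_kerQk _).2 (hgs.Qk_grad l hl'), hgs.curl_grad l, ?_⟩
  show Dl.projR (Dl.dstar (u - gradV1 P c l)) = 0
  rw [map_sub, map_sub, hgs.dstar_grad, Dl.projR_lap_of_mem hl', hlap, sub_self]

/-- **`∂(ker Q_k) = ∂(V411 P k)`**: the δ-gauge-free constraint `{Q_kA = 0}` and the k-axial gauge inside it have the same
plaquette variables (gen 3's accessibility of the axial gauge, `map_curlOp_V411_eq_of_gauge`; standing range, `c ≠ 0`).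
[cite: BalabanImbrieJaffe1985, (4.2.2) p.310] -/
theorem map_curlOp_kerQk_eq {k : ℕ} (hk : k ≤ P.m + P.K) (w : ℝ) {c : ℝ} (hc : c ≠ 0) (s : ℝ) :
    (V411 P k).map (curlOp (P := P) w c) = ((opsV1 P k c s).kerQk).map (curlOp (P := P) w c) :=
  (map_curlOp_V411_eq_of_gauge hk w hc
    (fun v hv => (mem_kerQk_iff k c s v).1 hv)
    (fun A hA => ⟨toE P A, (mem_kerQk_iff k c s _).2 (by exact hA), rfl⟩)).symm

/-- **`∂G_k∂^* = ∂G_{k,Ax}∂^*` ON THE TORI** — p. 322's replacement, hypothesis-free in the standing range: for `G_k` = the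
Landau propagator of `(ker Q_k, ∂ = curlOp w c, T = R∂^*)` and the k-axial δ-gauge `V411 P k` of (4.1.1),
`∂ ∘ G_k ∘ ∂^* = ∂G_{k,Ax}∂^*` (`w > 0`, `c ≠ 0`, `k ≤ m + K`). [cite: BalabanImbrieJaffe1985, (7.1.12) p.322] -/
theorem curl_landauPropagator_curlAdj_torus {k : ℕ} (hk : k ≤ P.m + P.K) {w : ℝ} (hw : 0 < w) {c : ℝ} (hc : c ≠ 0) :
    curlOp (P := P) w c ∘ₗ
        landauPropagator (opsV1 P k c (Real.sqrt w)).kerQk (curlOp (P := P) w c) (landauT P k c (Real.sqrt w)) ∘ₗ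
          LinearMap.adjoint (curlOp (P := P) w c) =
      curlG (V411 P k) (curlOp (P := P) w c) := by
  have hs : Real.sqrt w ≠ 0 := (Real.sqrt_pos.2 hw).ne'
  have hZ := noLandauZeroModes_torus (P := P) hk hc hs
  have hAcc := landauAccessible_torus (P := P) hk c (Real.sqrt w)
  rw [opsV1_curl_eq_curlOp] at hZ hAcc
  exact curl_landauPropagator_curlAdj_eq_curlG hZ hAcc (noZeroModes_V411_holds hk hw hc) (map_curlOp_kerQk_eq hk w hc _)

/-- **σ_k = `Q^{e*†}_k(I − ∂G_k∂^*)Q^{e*}_k` ON THE TORI** — the torus σ_k of (4.2.1)–(4.2.2) (`sigmaTorus`, defined with the axial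
`G_{k,Ax}`) written with the Landau `G_k`, as Sect. 7 uses it from (7.1.12) on (`w > 0`, `c ≠ 0`, `k ≤ m + K`, `2 ≤ d`).
[cite: BalabanImbrieJaffe1985, (7.1.12) p.322] -/
theorem sigmaTorus_eq_landau (hd : 2 ≤ P.d) {k : ℕ} (hk : k ≤ P.m + P.K) {w : ℝ} (hw : 0 < w) {c : ℝ} (hc : c ≠ 0) :
    sigmaTorus (P := P) hd w c k =
      LinearMap.adjoint (QesOp (P := P) hd w k) ∘ₗ
        (LinearMap.id - curlOp (P := P) w c ∘ₗ
          landauPropagator (opsV1 P k c (Real.sqrt w)).kerQk (curlOp (P := P) w c) (landauT P k c (Real.sqrt w)) ∘ₗ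
            LinearMap.adjoint (curlOp (P := P) w c)) ∘ₗ QesOp (P := P) hd w k := by
  unfold sigmaTorus sigmaOp
  rw [curl_landauPropagator_curlAdj_torus hk hw hc]

/-- **`G_k` on the torus IS the propagator (4.1.1) with `δ_{k,Ax}(A)` replaced by `𝒢(∂^*A)`**, with p11's weight
`weight = 𝒢(∂^*A)e^{−½‖∂A‖²}` of (4.4.1)–(4.4.3) VERBATIM: `exp(½⟨J, G_kJ⟩) = (∫_{Q_kA=0}𝒢(∂^*A)e^{−½‖∂A‖²}dA)⁻¹ ∫_{Q_kA=0}
𝒢(∂^*A)e^{−½‖∂A‖²}e^{⟨A,J⟩}dA` for every source `J` (p11's `weight_eq`: the weight is `c_R⁻¹e^{−½‖∂A‖²−½‖R∂^*A‖²}`, `c_R > 0`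
by `cR_pos`/`lapInjective_V1`, and the constant cancels); standing range, `w > 0`, `c ≠ 0`. [cite: BalabanImbrieJaffe1985, (4.1.1) p.309] -/
theorem landauPropagator_torus_weight {k : ℕ} (hk : k ≤ P.m + P.K) {w : ℝ} (hw : 0 < w) {c : ℝ} (hc : c ≠ 0)
    (J : BondSpace P) :
    Real.exp ((1 / 2) * ⟪J, landauPropagator (opsV1 P k c (Real.sqrt w)).kerQk (curlOp (P := P) w c)
        (landauT P k c (Real.sqrt w)) J⟫) =
      (∫ v : (opsV1 P k c (Real.sqrt w)).kerQk, weight (opsV1 P k c (Real.sqrt w)) (v : BondSpace P))⁻¹ *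
        ∫ v : (opsV1 P k c (Real.sqrt w)).kerQk,
          weight (opsV1 P k c (Real.sqrt w)) (v : BondSpace P) * Real.exp ⟪(v : BondSpace P), J⟫ := by
  set Dl := opsV1 P k c (Real.sqrt w) with hDl
  have hs : Real.sqrt w ≠ 0 := (Real.sqrt_pos.2 hw).ne'
  have hZ := noLandauZeroModes_torus (P := P) hk hc hs
  rw [opsV1_curl_eq_curlOp] at hZ
  obtain ⟨h, -⟩ := isLandauPropagator (N := Dl.kerQk) hZ
  have hcR : 0 < cR Dl := cR_pos Dl (fun l hQ hΔ => lapInjective_V1 k hc hs l hQ hΔ)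
  -- the weight in Gaussian form: `weight v = c_R⁻¹·exp(−½(‖∂v‖² + ‖R∂^*v‖²))`
  have hwt : ∀ v : BondSpace P, weight Dl v =
      (cR Dl)⁻¹ * Real.exp (-(1 / 2) * (‖curlOp (P := P) w c v‖ ^ 2 + ‖landauT P k c (Real.sqrt w) v‖ ^ 2)) := by
    intro v
    rw [weight_eq, LandauOps.energy, ← opsV1_curl_eq_curlOp k w c]
    congr 2
    show -(1 / 2 * ‖Dl.curl v‖ ^ 2 + 1 / 2 * ‖Dl.projR (Dl.dstar v)‖ ^ 2) =
      -(1 / 2) * (‖Dl.curl v‖ ^ 2 + ‖Dl.projR (Dl.dstar v)‖ ^ 2)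
    ring
  have hwt' : ∀ v : BondSpace P, weight Dl v * Real.exp ⟪v, J⟫ =
      (cR Dl)⁻¹ * Real.exp (-(1 / 2) * (‖curlOp (P := P) w c v‖ ^ 2 + ‖landauT P k c (Real.sqrt w) v‖ ^ 2) + ⟪v, J⟫) := by
    intro v
    rw [hwt, mul_assoc, ← Real.exp_add]
  simp_rw [hwt', hwt, integral_const_mul]
  rw [h J]
  exact (cancel_aux _ _ hcR.ne').symm

end Torus

end

end Literature.MathematicalPhysics.QuantumFieldTheory.BalabanImbrieJaffe1984to88.BIJ85LandauCurlG
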